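import Summits.NavierStokesRegularity.NavierStokesRegularity.Theses.AxisymmetricExtremality
import Summits.NavierStokesRegularity.NavierStokesRegularity.Theorems.AxisymmetricExtremalityPFoldToAxisymmetricCompactModuloSim
import Summits.NavierStokesRegularity.NavierStokesRegularity.Theorems.AxisymmetricExtremalityPFoldToAxisymmetricAxisPinning
import Summits.NavierStokesRegularity.NavierStokesRegularity.Theorems.AxisymmetricExtremalityPFoldToAxisymmetricDenseAngleClosure
import Summits.NavierStokesRegularity.NavierStokesRegularity.Theorems.AxisymmetricExtremalityPFoldToAxisymmetricAeAxisymmetricUpgrade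

/-!
# Route AxisymmetricExtremality — crux `PFoldToAxisymmetric` (item stmt-NavierStokesRegularity-15454), PROVED

Line `birth` (skeleton `Cruxes/PFoldToAxisymmetric/Lines/birth.lean`), composition of the four
landed stubs:

* `…CompactModuloSim.stub_compactModuloSim` — Rusin–Šverák Cor. 4.3 at full strength in `L³`
  form: minimal blow-up data, modulated by scalings/translations, converge along a subsequence
  in `L³` to a MINIMAL blow-up datum;
* `…AxisPinning.stub_axisPinning` — the symmetry axes of modulated `p_j`-fold symmetric data stay
  at bounded distance (escape/periodicity argument on `L³`), so recentred, exactly equivariant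
  fields converge to a minimal datum;
* `…DenseAngleClosure.stub_denseAngleClosure` — an `L³` limit of `(2π/q_j)`-equivariant fields,
  `q_j → ∞`, is a.e.-equivariant under every rotation about the `x 2`-axis;
* `…AeAxisymmetricUpgrade.stub_aeAxisymmetricUpgrade` — an a.e.-axisymmetric minimal blow-up
  datum has an everywhere axisymmetric representative, again a minimal blow-up datum.

THE CRUX. For `ν > 0`: if for unboundedly many `p ≥ 2` there are `p`-fold symmetric
Rusin–Šverák minimal blow-up data, then an axisymmetric minimal blow-up datum exists.
-/

noncomputable section

-- single-conjunct summit: `Summit.<Summit>.<Problem>` repeats the name by the D-0017 layout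
set_option linter.dupNamespace false

namespace Summit.NavierStokesRegularity.NavierStokesRegularity.Theorems

open MeasureTheory Filter Topology
open scoped ENNReal

/-- **Crux `PFoldToAxisymmetric` of route AxisymmetricExtremality, proved** (item
stmt-NavierStokesRegularity-15454, line `birth`): for `ν > 0`, if for every `N` there is a `p ≥ N`,
`p ≥ 2`, and a `p`-fold symmetric Rusin–Šverák minimal blow-up datum (equivariance under the
rotation by `2π/p` about the `x 2`-axis), then there is an axisymmetric minimal blow-up datum
(equivariance under every rotation about the `x 2`-axis). Proof: choose the symmetric data along
`N ↦ p N ≥ N`; modulate and pass to a minimal `L³`-limit (stub 1); pin and recentre the axes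
(stub 2, with `p ∘ φ → ∞`); close the dense subgroup of angles (stub 3); upgrade the
a.e.-axisymmetric minimal datum to an everywhere axisymmetric one (stub 4).
[cite: RusinSverak2011, Cor. 4.3 (arXiv:0911.0500 p. 8)] -/
theorem axisymmetricExtremality_pFoldToAxisymmetric_proof :
    Summit.NavierStokesRegularity.NavierStokesRegularity.Theses.AxisymmetricExtremality.PFoldToAxisymmetric := by
  intro ν hν hfold
  -- the crux hypothesis: for every `N` a `p N`-fold symmetric minimal blow-up datum with `N ≤ p N`
  choose p hpN _hp2 U G hmin hsym using hfold
  -- stub 1: modulate by `Sim` and pass to a minimal `L³`-limit along a subsequence `φ`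
  obtain ⟨lam, x₀, φ, u, g, hlam, hφ, hminu, hconv⟩ :=
    PFoldToAxisymmetric.CompactModuloSim.stub_compactModuloSim ν hν U G hmin
  -- the orders of symmetry still diverge along the subsequence
  have hq : Tendsto (fun j => p (φ j)) atTop atTop :=
    tendsto_atTop_mono (fun j => (hφ.id_le j).trans (hpN (φ j))) tendsto_id
  -- stub 2: pin the axes and recentre them on the `x 2`-axis
  obtain ⟨u', g', hmin', q', V, hq', hV, hsymV, hconv'⟩ :=
    PFoldToAxisymmetric.AxisPinning.stub_axisPinning ν hν (fun j => U (φ j)) (fun j => G (φ j))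
      (fun j => p (φ j)) lam x₀ u g (fun j => hmin (φ j)) (fun j x => hsym (φ j) x) hq hlam hminu hconv
  -- stub 3: the limit is a.e.-equivariant under every rotation about the `x 2`-axis
  have hae := PFoldToAxisymmetric.DenseAngleClosure.stub_denseAngleClosure u' q' V hmin'.1 hV hq'
    hsymV hconv'
  -- stub 4: upgrade to an everywhere axisymmetric minimal blow-up datum
  exact PFoldToAxisymmetric.AeAxisymmetricUpgrade.stub_aeAxisymmetricUpgrade ν u' g' hmin' hae

end Summit.NavierStokesRegularity.NavierStokesRegularity.Theorems

end
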